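import Mathlib
import Summits.ValiantsHypothesis.ValiantsHypothesis.Theorems.RigidityForcesSymmetryRankRigidMinimalReprLaplaceDefs

/-!
# The full-support lemma for quadratic zeon coefficients (heart of «lemma Z» for the residual `a = 3` configurations)
# (crux `RankRigidMinimalRepr`, stmt-ValiantsHypothesis-18034; frontier rung `LaplaceOptimalFive`, stmt-24813)

In the zeon reading of the dual witness (`per(φ) =` top coefficient of `Π_s ℓ_{φ_s}` in `ℂ[y]/(y_c²)`), the `3 × 3`
permanents of three covectors `z, φ₁, φ₂` on the letters `{a,b,c}` are `z_a g_{bc} + z_b g_{ac} + z_c g_{ab}` with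
`g_{ab} = φ₁(a)φ₂(b) + φ₁(b)φ₂(a)` the `2 × 2` permanents.  LEMMA (this file, `pairs_vanish_of_full_support`): if every
coordinate of `z` is non-zero and all ten triple combinations vanish, then all `g_{ab}` vanish — i.e. a degree-one zeon
element with FULL support annihilates no non-zero degree-two element on five letters (equivalently: the `10 × 10`
pairs-versus-triples inclusion matrix of a 5-set is invertible).  Proof: for four letters the triple relations give
`z_c z_d g_{ab} = z_a z_b g_{cd}` for disjoint pairs, and the fifth letter's triple then gives `3 z_c z_d z_e g_{ab} = 0`
(one `linear_combination`).  Stated for any `g : Fin 5 → Fin 5 → ℂ` (the relations fix the orientation); no permanents, no definitions.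
Use (blueprint, evidence note NOTE-p8g11-24813 §v3 on stmt-24813): with `permanent_two_slot` (`…LaplaceResidualTools.lean`)
it yields «φ₀ with full support and all 3 × 3 permanents of (φ₀;φ₁;φ₂) zero ⇒ all 2 × 2 permanents of (φ₁;φ₂) zero», the
CASE-1 key of the last four configurations of `laplace_five_three_slices_residual`.

HONEST FRAMING: infrastructure toward the frontier rung `LaplaceOptimalFive` (stmt-24813), which stays OPEN; nothing here
bears on `VP ≠ VNP`.
-/

set_option autoImplicit false

-- the mandated summit-side namespace repeats a component by design (single-problem summit)
set_option linter.dupNamespace false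

namespace Summit.ValiantsHypothesis.ValiantsHypothesis.Theorems.RigidityForcesSymmetryRankRigidMinimalRepr

namespace LaplaceResidual

/-- Five letters: two distinct ones have three further pairwise distinct companions. -/
theorem exists_three_others : ∀ a b : Fin 5, a ≠ b → ∃ c d e : Fin 5,
    c ≠ a ∧ c ≠ b ∧ d ≠ a ∧ d ≠ b ∧ e ≠ a ∧ e ≠ b ∧ c ≠ d ∧ c ≠ e ∧ d ≠ e := by
  decide

/-- **Full-support lemma.**  `z` with all coordinates non-zero, `g` arbitrary (only the entries `g a b` in the orientation of the hypotheses enter); if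
`z a * g b c + z b * g a c + z c * g a b = 0` for all pairwise distinct `a, b, c`, then `g a b = 0` for all `a ≠ b`. -/
theorem pairs_vanish_of_full_support (z : Fin 5 → ℂ) (hz : ∀ c, z c ≠ 0) (g : Fin 5 → Fin 5 → ℂ)
    (htri : ∀ a b c : Fin 5, a ≠ b → a ≠ c → b ≠ c → z a * g b c + z b * g a c + z c * g a b = 0) :
    ∀ a b : Fin 5, a ≠ b → g a b = 0 := by
  intro a b hab
  obtain ⟨c, d, e, hca, hcb, hda, hdb, hea, heb, hcd, hce, hde⟩ := exists_three_others a b hab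
  -- the triple relations on {a,b,c,d}, {a,b,c,e}, {a,b,d,e} and {c,d,e}
  have r_abc := htri a b c hab hca.symm hcb.symm
  have r_abd := htri a b d hab hda.symm hdb.symm
  have r_acd := htri a c d hca.symm hda.symm hcd
  have r_bcd := htri b c d hcb.symm hdb.symm hcd
  have r_abe := htri a b e hab hea.symm heb.symm
  have r_ace := htri a c e hca.symm hea.symm hce
  have r_bce := htri b c e hcb.symm heb.symm hce
  have r_ade := htri a d e hda.symm hea.symm hde
  have r_bde := htri b d e hdb.symm heb.symm hde
  have r_cde := htri c d e hcd hce hde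
  -- 3 z_c z_d z_e · g a b = 0
  have key : 3 * (z c * z d * z e) * g a b = 0 := by
    linear_combination z a * z b * r_cde
      + (1/2 : ℂ) * z e * (z d * r_abc + z c * r_abd - z b * r_acd - z a * r_bcd)
      + (1/2 : ℂ) * z d * (z e * r_abc + z c * r_abe - z b * r_ace - z a * r_bce)
      + (1/2 : ℂ) * z c * (z e * r_abd + z d * r_abe - z b * r_ade - z a * r_bde)
  have h3 : (3 : ℂ) * (z c * z d * z e) ≠ 0 :=
    mul_ne_zero (by norm_num) (mul_ne_zero (mul_ne_zero (hz c) (hz d)) (hz e))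
  exact (mul_eq_zero.mp key).resolve_left h3

end LaplaceResidual

end Summit.ValiantsHypothesis.ValiantsHypothesis.Theorems.RigidityForcesSymmetryRankRigidMinimalRepr
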